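import Literature.Computability.Complexity.GateEliminationCase5Chain
import Literature.Computability.Complexity.GateEliminationWiresUntouched

/-!
# Gate elimination: the main strategy of Case 5 with a fourth elimination

A complement to `GateEliminationCase5Chain.lean` for the sub-case analyses of Case 5 of
Li–Yang's Theorem 4.1 (ECCC TR21-023, §4.1): when the elimination of `B` (the third gate of the
chain `x := b`; `G`, `D`, `B`) replaces the wires out of `B` by a constant, a reader `F` of `B`
becomes fed by a constant and is eliminated as a fourth gate (Rules 2/3). If moreover at most one
troubled gate without a troubled ancestor-image appeared along the chain, the accounting is
`Δμ ≥ 4 - α_φ + α_I ≥ δ` (`case5_main4`: four gates, the influential `x`, the destroyed troubled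
`G`, at most one new troubled gate, and `ΔΦ ≤ 1` for the fourth elimination). This covers a
configuration the printed Case 5.2 passes over (a third reader of `D` becoming troubled when `B`
is trivialized by the substitution).

## References

* J. Li, T. Yang, *3.1n − o(n) circuit lower bounds for explicit functions*, STOC 2022;
  ECCC TR21-023, §4.1 (Case 5), Lemma 3.11.
-/

namespace Literature.Computability.Complexity

open Finset

namespace Semicircuit

variable {n : ℕ} {C : Semicircuit n} {f : (Fin n → ZMod 2) → Bool} {R : RdqSource n} {d : ℕ}
  {αφ αI αQ : ℝ} {G : Fin C.m} {x y : Fin n} {B C' D : Fin C.m} {aX aB aC aD : Fin 2}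

/-- `δ ≤ α_I + (4 - α_φ)` for `α_φ ≥ 0`. [cite: LiYang2022, Lemma 3.11 / proof of Thm. 1.1] -/
theorem liYangDelta_le_four_sub (αφ αI αQ : ℝ) (hφ : 0 ≤ αφ) : liYangDelta αφ αI αQ ≤ αI + (4 - αφ) := by
  have := liYangDelta_le_case3 αφ αI αQ
  linarith

section Chain

variable (hf : IsAffineDisperser f d) (hd : 2 * d + 2 < R.dim) (hF : C.Fair) (hC : C.ComputesRestr f R)
  (hS : C.Standing R) (hcfg : C.Case5Config G x y B C' D aX aB aC aD) (hφ : 0 ≤ αφ) (hI : 0 ≤ αI) (αQ : ℝ)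

/-- The composite embedding of the gates after the three eliminations into the gates of `C`. [folklore] -/
noncomputable def case5pre (T : Fin (case5E₃ hf hd hF hC hS hcfg hφ hI αQ).C'.m) : Fin C.m :=
  (case5E₁ hf hd hF hC hS hcfg hφ hI αQ).ι ((case5E₂ hf hd hF hC hS hcfg hφ hI αQ).ι ((case5E₃ hf hd hF hC hS hcfg hφ hI αQ).ι T))

/-- It is injective. [folklore] -/
theorem case5pre_injective : Function.Injective (case5pre hf hd hF hC hS hcfg hφ hI αQ) := fun _ _ h =>
  (case5E₃ hf hd hF hC hS hcfg hφ hI αQ).ι_injective ((case5E₂ hf hd hF hC hS hcfg hφ hI αQ).ι_injective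
    ((case5E₁ hf hd hF hC hS hcfg hφ hI αQ).ι_injective h))

include hf hd hF hC hS hcfg hφ hI in
/-- **Counting troubled gates after the chain**: if at most one troubled gate has an untroubled
image in `C[x := b]`, then `#troubled + 1 ≤ #troubled(C) + 1`, i.e. `≤ #troubled(C)` (the image
misses the destroyed troubled gate `G`). [cite: LiYang2022, §4.1 (Case 5)] -/
theorem case5_troubledCount_le_of_atMostOne
    (h1 : ∀ T T', (case5E₃ hf hd hF hC hS hcfg hφ hI αQ).C'.Troubled T → (case5E₃ hf hd hF hC hS hcfg hφ hI αQ).C'.Troubled T' →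
      ¬ (case5C₁ hcfg).Troubled (case5pre (C := C) hf hd hF hC hS hcfg hφ hI αQ T) →
      ¬ (case5C₁ hcfg).Troubled (case5pre (C := C) hf hd hF hC hS hcfg hφ hI αQ T') → T = T') :
    (case5E₃ hf hd hF hC hS hcfg hφ hI αQ).C'.troubledCount ≤ C.troubledCount := by
  classical
  unfold troubledCount
  set T₃ := univ.filter fun k => (case5E₃ hf hd hF hC hS hcfg hφ hI αQ).C'.Troubled k with hT₃
  set T₀ := univ.filter fun k => C.Troubled k with hT₀
  let φ := case5pre hf hd hF hC hS hcfg hφ hI αQ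
  -- split `T₃` into old and new
  let Told := T₃.filter fun k => (case5C₁ hcfg).Troubled (φ k)
  let Tnew := T₃.filter fun k => ¬ (case5C₁ hcfg).Troubled (φ k)
  have hsplit : Told.card + Tnew.card = T₃.card := card_filter_add_card_filter_not _
  have hnew : Tnew.card ≤ 1 := by
    rw [card_le_one]
    intro a ha b hb
    rw [mem_filter, hT₃, mem_filter] at ha hb
    exact h1 a b ha.1.2 hb.1.2 ha.2 hb.2
  have hGT : G ∈ T₀ := by rw [hT₀, mem_filter]; exact ⟨mem_univ _, hcfg.troubled⟩
  have hmaps : ∀ k ∈ Told, φ k ∈ T₀.erase G := by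
    intro k hk
    rw [mem_filter] at hk
    rw [mem_erase, hT₀, mem_filter]
    refine ⟨fun hG => ?_, mem_univ _, troubled_of_troubled_substConst (C := C) hk.2⟩
    have h2 := hk.2
    change (case5C₁ hcfg).Troubled (φ k) at h2
    rw [hG] at h2
    exact not_troubled_of_reads_const (case5C₁_arg_G hcfg) h2
  have hinj : Set.InjOn φ Told := fun a _ b _ h => case5pre_injective hf hd hF hC hS hcfg hφ hI αQ h
  have hold := card_le_card_of_injOn φ hmaps hinj
  rw [card_erase_of_mem hGT] at hold
  have hpos := card_pos.mpr ⟨G, hGT⟩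
  omega

include hf hd hF hC hS hcfg hφ hI in
/-- **The main strategy of Case 5 with a fourth elimination**: if the elimination of `B` replaces
its out-wires by a constant, a reader `F ∉ {G, D}` of `B` is then fed by a constant and is
eliminated too; with at most one new troubled gate along the chain,
`Δμ ≥ 4 - α_φ + α_I ≥ δ`, one substitution. [cite: LiYang2022, §4.1 (Case 5), Lemma 3.11] -/
theorem case5_main4 (hrepl : ∃ b, (case5E₃ hf hd hF hC hS hcfg hφ hI αQ).repl = .const b)
    {F : Fin C.m} {aF : Fin 2} (hFB : C.arg F aF = .gate B) (hFG : F ≠ G) (hFD : F ≠ D) (hFB' : F ≠ B)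
    (h1 : ∀ T T', (case5E₃ hf hd hF hC hS hcfg hφ hI αQ).C'.Troubled T → (case5E₃ hf hd hF hC hS hcfg hφ hI αQ).C'.Troubled T' →
      ¬ (case5C₁ hcfg).Troubled (case5pre (C := C) hf hd hF hC hS hcfg hφ hI αQ T) →
      ¬ (case5C₁ hcfg).Troubled (case5pre (C := C) hf hd hF hC hS hcfg hφ hI αQ T') → T = T') :
    C.StepGoal f R αφ αI αQ := by
  classical
  set E₁ := case5E₁ hf hd hF hC hS hcfg hφ hI αQ with hE₁
  set E₂ := case5E₂ hf hd hF hC hS hcfg hφ hI αQ with hE₂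
  set E₃ := case5E₃ hf hd hF hC hS hcfg hφ hI αQ with hE₃
  obtain ⟨b₃, hb₃⟩ := hrepl
  have hx := case5_free_x hC hcfg
  have hxp := case5_unprot_x hS hcfg
  -- `F` along the chain
  obtain ⟨kF₁, hkF₁⟩ := E₁.ι_surj F hFG
  have hkF₁D : kF₁ ≠ case5kD hf hd hF hC hS hcfg hφ hI αQ := by
    intro h; have := congrArg E₁.ι h; rw [hkF₁, case5kD_spec] at this; exact hFD this
  obtain ⟨kF₂, hkF₂⟩ := E₂.ι_surj kF₁ hkF₁D
  have hkF₂B : kF₂ ≠ case5kB hf hd hF hC hS hcfg hφ hI αQ := by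
    intro h; have := congrArg E₂.ι h; rw [hkF₂, case5kB_spec] at this
    have := congrArg E₁.ι this; rw [hkF₁, case5kB₁_spec] at this; exact hFB' this
  obtain ⟨kF₃, hkF₃⟩ := E₃.ι_surj kF₂ hkF₂B
  have h1' : (case5C₁ hcfg).arg F aF = .gate B := by
    rw [case5C₁_arg_of_ne hcfg (by rw [hFB]; exact fun h => by cases h), hFB]
  have h2' : E₁.C'.arg kF₁ aF = .gate (case5kB₁ hf hd hF hC hS hcfg hφ hI αQ) := by
    rw [E₁.arg_eq_gate_iff, hkF₁, case5kB₁_spec]; exact Or.inl h1'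
  have h3' : E₂.C'.arg kF₂ aF = .gate (case5kB hf hd hF hC hS hcfg hφ hI αQ) := by
    rw [E₂.arg_eq_gate_iff, hkF₂, case5kB_spec]; exact Or.inl h2'
  have h4' : E₃.C'.arg kF₃ aF = .const b₃ := by
    rw [E₃.arg_eq_const_iff, hkF₃]; exact Or.inr ⟨h3', hb₃⟩
  -- the fourth elimination
  let E₄ := elimDataWConstFed hf ((case5R₁_dim hC hS hcfg).mpr hd) E₃.fair E₃.computes E₃.C'.isPacking_empty h4' hφ hI αQ
  -- accounting
  have hT₃ := case5_troubledCount_le_of_atMostOne hf hd hF hC hS hcfg hφ hI αQ h1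
  have hpot : (E₄.C'.potential E₄.P' : ℝ) ≤ C.potential ∅ + 1 := by
    have h0 : (E₄.C'.potential E₄.P' : ℝ) ≤ E₃.C'.potential ∅ + 1 := E₄.potential_le
    unfold potential at h0 ⊢
    simp only [card_empty, Nat.cast_zero, sub_zero] at h0 ⊢
    have : (E₃.C'.troubledCount : ℝ) ≤ C.troubledCount := by exact_mod_cast hT₃
    linarith
  have hxinf : x ∈ C.influential R := C.mem_influential_of_reads R hcfg.arg_G_x
  have hinf₁ : (((case5C₁ hcfg).influential (case5R₁ hC hS hcfg)).card : ℝ) + 1 ≤ (C.influential R).card := by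
    have h1 := card_le_card (C.influential_substConst_assignFree_subset hx hxp (case5c hcfg) (finTwoEquiv (case5c hcfg)))
    have h3 := card_erase_add_one hxinf
    have : ((case5C₁ hcfg).influential (case5R₁ hC hS hcfg)).card + 1 ≤ (C.influential R).card := by
      change ((C.substConst x (finTwoEquiv (case5c hcfg))).influential (R.assignFree x (case5c hcfg) hx hxp)).card + 1 ≤ _
      omega
    exact_mod_cast this
  have hinf₄ : ((E₄.C'.influential (case5R₁ hC hS hcfg)).card : ℝ) ≤ ((case5C₁ hcfg).influential (case5R₁ hC hS hcfg)).card := by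
    have h1 := E₄.influential_subset (case5R₁ hC hS hcfg)
    have h2 := E₃.influential_subset (case5R₁ hC hS hcfg)
    have h3 := E₂.influential_subset (case5R₁ hC hS hcfg)
    have h4 := E₁.influential_subset (case5R₁ hC hS hcfg)
    exact_mod_cast card_le_card (h1.trans (h2.trans (h3.trans h4)))
  have hm : (E₄.C'.m : ℝ) + 4 = C.m := by
    have h1 : E₁.C'.m + 1 = C.m := E₁.m_add_one
    have h2 : E₂.C'.m + 1 = E₁.C'.m := E₂.m_add_one
    have h3 : E₃.C'.m + 1 = E₂.C'.m := E₃.m_add_one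
    have h4 : E₄.C'.m + 1 = E₃.C'.m := E₄.m_add_one
    have : E₄.C'.m + 4 = C.m := by omega
    exact_mod_cast this
  have hq : ((case5R₁ hC hS hcfg).quadCount : ℝ) = R.quadCount := by
    show ((R.assignFree x (case5c hcfg) hx hxp).quadCount : ℝ) = _
    rw [RdqSource.quadCount_assignFree]
  have hdim : (case5R₁ hC hS hcfg).dim + 1 = R.dim := RdqSource.dim_assignFree hx hxp
  refine Or.inr ⟨1, le_rfl, by norm_num, E₄.C', case5R₁ hC hS hcfg, E₄.P', E₄.fair, E₄.computes, E₄.packing, hdim, ?_⟩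
  rw [Nat.cast_one, mul_one]
  have hδ := liYangDelta_le_four_sub αφ αI αQ hφ
  unfold measure
  rw [hq]
  unfold potential at hpot ⊢
  simp only [card_empty, Nat.cast_zero, sub_zero] at hpot ⊢
  nlinarith [mul_le_mul_of_nonneg_left hinf₁ hI, mul_le_mul_of_nonneg_left hinf₄ hI, mul_le_mul_of_nonneg_left hpot hφ]

end Chain

end Semicircuit

end Literature.Computability.Complexity
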